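import Literature.AlgebraicGeometry.Resolution.BlowupAlgebraPresentation
import Literature.AlgebraicGeometry.Resolution.BlowupAlgebraLift
import Literature.AlgebraicGeometry.Resolution.BlowupAlgebraQuasiRegularChart
import Summits.ResolutionOfSingularities.ResolutionOfSingularities.Theorems.EquisingularLiftEquisingularLiftNatExceptionalLineCone
import Mathlib.RingTheory.Localization.Ideal
import HarnessLib

/-!
# The strict transform of a GRAPH-TYPE hypersurface under the blowing up of a quasi-regular centre is a regular ring;
# the ODP family `𝒩 = x_p x_{p'} + x_q x_{q'}` (F3-core of E4″@G, O10 §B/§D)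
# (crux `FInjectiveMacaulayfication` stmt-ResolutionOfSingularities-15315, chain w45a; res-L1-w45a-plan-1 R18.27 + amendment «(F3)-core → stub-1 g10»;
# seat res-L1-w45a-stub-1 g10; typing plan res-L1-w45a-stub-3 g9 `E4-STEP-TYPING.md` §D)

[OURS · L1 W4.5a] Support file (`--supports stmt-ResolutionOfSingularities-15315 --as helper`); replaces the role of NO printed item; NOT a statement of any
manuscript; def-free; UNCONDITIONAL; pure commutative algebra (no schemes). AI-written (AI review is weaker than expert review).

SETTING. `R` a Noetherian ring, `x = (x₁, …, x_r)` QUASI-REGULAR with `R/I` a REGULAR DOMAIN (`I = (x)`), chart `B = R[I/xᵢ] ⊆ L = R[1/xᵢ]` (`blowupAlgebra`) with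
fractions `x_j/xᵢ` (`blowupAlgebra.frac`) and evaluation `eval : R[T_j : j ≠ i] → B` (`BlowupAlgebraPresentation`). `H = T_{j₀} + q(T_j : j ≠ i, j₀)`, LINEAR IN ONE
CHART VARIABLE WHICH DOES NOT OCCUR ELSEWHERE, is called GRAPH TYPE; `h′ = eval H ∈ B` is the typical strict transform of a hypersurface `𝒩 ∈ I²` whose tangent cone is
non-degenerate in the direction `x_{j₀}` — e.g. the ODP family `𝒩 = x_p x_{p'} + x_q x_{q'}` on the chart `x_p`: `𝒩 = x_p² · (x_{p'}/x_p + (x_q/x_p)(x_{q'}/x_p))`.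
* §1 `nonempty_algEquiv_quotient_X_add_rename` — `A[T_σ]/(T_{j₀} + q) ≃ₐ A[T_j : j ≠ j₀]` for `q` free of `T_{j₀}`; hence regular for `A` regular. [folklore]
* §2 (any ring `S`, elements `a₀, h`) `mk_mem_nonZeroDivisors_of_not_mem` — `(a₀)` prime, `a₀` a non-zero-divisor, `h ∉ (a₀)` ⇒ `ā₀` is a non-zero-divisor of `S/(h)`;
  ★ `isRegularRing_quotient_of_sup_of_away` — if moreover `S/(a₀, h)` is a regular ring and `(S/(h))[1/ā₀]` is (a localisation of `S/(h)` at `ā₀` which is) a regular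
  ring, then `S/(h)` is a regular ring (Liu 8.1.19 (a) pattern: regularity lifts modulo the regular element `ā₀` at primes containing it; localisation elsewhere).
* §3 (the chart) `eval_X_add_rename_not_mem_span` (coefficient test, Stacks 0BIQ), `nonempty_ringEquiv_quotient_sup` (`B/(xᵢ, h′) ≅ (R/I)[T_j : j ≠ i]/(T_{j₀} + q̄)`),
  `isLocalization_away_quotient` (`(B/(h′))[1/x̄ᵢ] = L/(h′)`, Stacks 07Z3 (3)), and ★★ `isRegularRing_quotient_eval_graphType`: **`B/(h′)` IS A REGULAR RING provided
  `L/(h′) = R[1/xᵢ]/(𝒩)` is** (the hypersurface is regular off `V(xᵢ)` — the consumer's Jacobian fact). No regularity of `R` itself is used.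
* §4 the ODP family: `algebraMap_odp_eq` (`𝒩/1 = (x_p/1)² · h′_p`), `not_dvd_odp` and the tree's `Cruxes.EquisingularLiftNat.Sections.prime_algebraMap_of_isQuasiRegular`
  (`x_p/1` prime; `EquisingularLiftEquisingularLiftNatExceptionalLineCone.lean`) — the inputs of
  `BlowupAlgebraStrictTransform.quotientKerBlowupAlgebraMapEquiv` (the `x_p`-chart ring of the blowing up of `R/(𝒩)` along `I·(R/𝒩)` IS `B/(h′_p)`) — and
  ★★ `isRegularRing_quotient_odp`: `B/(h′_p)` is a regular ring provided `R[1/x_p]/(𝒩)` is. By the symmetries `p ↔ p'`, `(p,p') ↔ (q,q')` this covers all four charts: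
  de Jong's «Chart "t₁ ≠ 0": u′v′ − t₂′ t₃ ⋯ t_s = 0» at `s = 2`, freed from power series, and the E4″ floor-2 chart `a′b′ + w₁ g`, centre `(a′, b′, w₁, g)`.
[folklore; cite: Liu2002, Thm. 8.1.19 (a)] [cite: StacksProject, Tag 0BIQ; Tag 07Z3] [cite: GortzWedhorn2020, Prop. 13.96 (2), (13.19)] [cite: DeJong1996, 4.27 (p. 76)]
-/

-- single-problem summit: the doubled namespace component is forced
set_option linter.dupNamespace false

noncomputable section

namespace Summit.ResolutionOfSingularities.ResolutionOfSingularities.Theorems.FInjectiveMacaulayfication.StrictTransformGraphType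

open MvPolynomial Literature.AlgebraicGeometry.Resolution

universe u v

/-! ## §1 The graph quotient `A[T_σ]/(T_{j₀} + q) ≅ A[T_j : j ≠ j₀]` -/

/-- **`A[T_σ]/(T_{j₀} + q) ≃ₐ[A] A[T_j : j ≠ j₀]`** for `q` a polynomial in the variables other than `T_{j₀}`: `T_{j₀} ↦ −q`, `T_j ↦ T_j`. [folklore] -/
theorem nonempty_algEquiv_quotient_X_add_rename {A : Type u} [CommRing A] {σ : Type v} [DecidableEq σ] (j₀ : σ)
    (q : MvPolynomial {j : σ // j ≠ j₀} A) :
    Nonempty ((MvPolynomial σ A ⧸ Ideal.span {X j₀ + rename (fun j : {j : σ // j ≠ j₀} => (j : σ)) q}) ≃ₐ[A]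
      MvPolynomial {j : σ // j ≠ j₀} A) := by
  -- `φ : T_{j₀} ↦ −q`, `T_j ↦ T_j`; `ι` = the inclusion of `A[T_j : j ≠ j₀]`
  let φ : MvPolynomial σ A →ₐ[A] MvPolynomial {j : σ // j ≠ j₀} A := aeval fun j => if h : j = j₀ then -q else X ⟨j, h⟩
  let ι : MvPolynomial {j : σ // j ≠ j₀} A →ₐ[A] MvPolynomial σ A := rename fun j => (j : σ)
  have hφι : ∀ p, φ (ι p) = p := by
    intro p
    change (φ.comp ι) p = AlgHom.id A _ p
    congr 1
    refine algHom_ext fun j => ?_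
    rw [AlgHom.comp_apply, AlgHom.id_apply]
    change φ (rename _ (X j)) = X j
    rw [rename_X]
    change aeval _ (X (j : σ)) = X j
    rw [aeval_X, dif_neg j.2]
  have hφH : φ (X j₀ + rename (fun j : {j : σ // j ≠ j₀} => (j : σ)) q) = 0 := by
    rw [map_add]
    change aeval _ (X j₀) + φ (ι q) = 0
    rw [aeval_X, dif_pos rfl, hφι, neg_add_cancel]
  -- `mk ∘ ι ∘ φ = mk`
  have hmk : ∀ p, Ideal.Quotient.mk (Ideal.span {X j₀ + rename (fun j : {j : σ // j ≠ j₀} => (j : σ)) q}) (ι (φ p)) =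
      Ideal.Quotient.mk (Ideal.span {X j₀ + rename (fun j : {j : σ // j ≠ j₀} => (j : σ)) q}) p := by
    intro p
    change ((Ideal.Quotient.mkₐ A _).comp (ι.comp φ)) p = Ideal.Quotient.mkₐ A _ p
    congr 1
    refine algHom_ext fun j => ?_
    rw [AlgHom.comp_apply, AlgHom.comp_apply, Ideal.Quotient.mkₐ_eq_mk]
    by_cases h : j = j₀
    · subst h
      change Ideal.Quotient.mk _ (ι (aeval _ (X j))) = _
      rw [aeval_X, dif_pos rfl, map_neg, Ideal.Quotient.eq, ← neg_add', Ideal.neg_mem_iff, add_comm]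
      exact Ideal.subset_span rfl
    · change Ideal.Quotient.mk _ (ι (aeval _ (X j))) = _
      rw [aeval_X, dif_neg h]
      change Ideal.Quotient.mk _ (rename _ (X _)) = _
      rw [rename_X]
  have hker : RingHom.ker φ.toRingHom = Ideal.span {X j₀ + rename (fun j : {j : σ // j ≠ j₀} => (j : σ)) q} := by
    apply le_antisymm
    · intro p hp
      have hp' : φ p = 0 := hp
      rw [← Ideal.Quotient.eq_zero_iff_mem, ← hmk, hp', map_zero, map_zero]
    · rw [Ideal.span_le, Set.singleton_subset_iff]
      exact hφH
  have hsurj : Function.Surjective φ := fun p => ⟨ι p, hφι p⟩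
  exact ⟨(Ideal.quotientEquivAlgOfEq A hker.symm).trans (Ideal.quotientKerAlgEquivOfSurjective hsurj)⟩

/-- Hence `A[T_σ]/(T_{j₀} + q)` is a regular ring when `A` is (finitely many variables). [folklore] -/
theorem isRegularRing_quotient_X_add_rename {A : Type u} [CommRing A] [IsRegularRing A] {σ : Type v} [Finite σ] [DecidableEq σ] (j₀ : σ)
    (q : MvPolynomial {j : σ // j ≠ j₀} A) :
    IsRegularRing (MvPolynomial σ A ⧸ Ideal.span {X j₀ + rename (fun j : {j : σ // j ≠ j₀} => (j : σ)) q}) := by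
  obtain ⟨e⟩ := nonempty_algEquiv_quotient_X_add_rename j₀ q
  haveI : IsRegularRing (MvPolynomial {j : σ // j ≠ j₀} A) := inferInstance
  exact IsRegularRing.of_ringEquiv (R := MvPolynomial {j : σ // j ≠ j₀} A) e.toRingEquiv.symm

/-! ## §2 Generic: regularity of `S/(h)` from `S/(a₀, h)` and `(S/(h))[1/ā₀]` -/

/-- If `(a₀)` is a prime ideal, `a₀` a non-zero-divisor and `h ∉ (a₀)`, then `ā₀` is a non-zero-divisor of `S/(h)`. [folklore] -/
theorem mk_mem_nonZeroDivisors_of_not_mem {S : Type u} [CommRing S] {a₀ h : S} (hprime : (Ideal.span {a₀}).IsPrime)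
    (ha₀ : a₀ ∈ nonZeroDivisors S) (hh : h ∉ Ideal.span {a₀}) :
    Ideal.Quotient.mk (Ideal.span {h}) a₀ ∈ nonZeroDivisors (S ⧸ Ideal.span {h}) := by
  rw [mem_nonZeroDivisors_iff_right]
  intro s hs
  obtain ⟨b, rfl⟩ := Ideal.Quotient.mk_surjective s
  rw [← map_mul, Ideal.Quotient.eq_zero_iff_mem, Ideal.mem_span_singleton] at hs
  obtain ⟨m, hm⟩ := hs
  -- `b a₀ = h m` ⇒ `m ∈ (a₀)` ⇒ `b = h m′`
  have hm' : h * m ∈ Ideal.span {a₀} := by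
    rw [← hm]; exact Ideal.mem_span_singleton'.mpr ⟨b, rfl⟩
  rcases hprime.mem_or_mem hm' with h1 | h1
  · exact absurd h1 hh
  · obtain ⟨m', rfl⟩ := Ideal.mem_span_singleton'.mp h1
    rw [Ideal.Quotient.eq_zero_iff_mem, Ideal.mem_span_singleton]
    refine ⟨m', (mul_cancel_right_mem_nonZeroDivisors ha₀).mp ?_⟩
    rw [hm]; ring

/-- ★ **Regularity of `S/(h)` from the exceptional and the open part.** `S` Noetherian, `ā₀` a non-zero-divisor of `S/(h)`, `S/((a₀) + (h))` a regular ring, and some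
localisation `T` of `S/(h)` at `ā₀` a regular ring ⇒ `S/(h)` is a regular ring: at primes containing `ā₀` regularity lifts modulo the regular element `ā₀`
(`isRegularLocalRing_localization_of_mem_of_quotient`); at the others `(S/(h))_𝔮` is a localisation of `T`. [folklore; cite: Liu2002, Thm. 8.1.19 (a)] -/
theorem isRegularRing_quotient_of_sup_of_away {S T : Type u} [CommRing S] [IsNoetherianRing S] [CommRing T] (a₀ h : S)
    (hnzd : Ideal.Quotient.mk (Ideal.span {h}) a₀ ∈ nonZeroDivisors (S ⧸ Ideal.span {h}))
    (hE : IsRegularRing (S ⧸ (Ideal.span {a₀} ⊔ Ideal.span {h})))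
    [Algebra (S ⧸ Ideal.span {h}) T] [IsLocalization.Away (Ideal.Quotient.mk (Ideal.span {h}) a₀) T] (hT : IsRegularRing T) :
    IsRegularRing (S ⧸ Ideal.span {h}) := by
  -- the exceptional part, as a quotient of `S/(h)`
  haveI : IsRegularRing ((S ⧸ Ideal.span {h}) ⧸ Ideal.span {Ideal.Quotient.mk (Ideal.span {h}) a₀}) := by
    refine IsRegularRing.of_ringEquiv (R := S ⧸ (Ideal.span {a₀} ⊔ Ideal.span {h})) ?_
    exact ((Ideal.quotEquivOfEq (sup_comm _ _)).trans (DoubleQuot.quotQuotEquivQuotSup (Ideal.span {h}) (Ideal.span {a₀})).symm).trans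
      (Ideal.quotEquivOfEq (by rw [Ideal.map_span, Set.image_singleton]))
  rw [isRegularRing_iff]
  intro Q hQ
  by_cases hmem : Ideal.Quotient.mk (Ideal.span {h}) a₀ ∈ Q
  · exact isRegularLocalRing_localization_of_mem_of_quotient hnzd Q hmem
  · -- `(S/(h))_Q ≅ T_{Q T}`, a localisation of the regular ring `T`
    have hdisj : Disjoint (Submonoid.powers (Ideal.Quotient.mk (Ideal.span {h}) a₀) : Set (S ⧸ Ideal.span {h})) (Q : Set (S ⧸ Ideal.span {h})) := by
      rw [Set.disjoint_left]
      rintro _ ⟨n, rfl⟩ hn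
      exact hmem (hQ.mem_of_pow_mem n hn)
    haveI hQ'p : (Q.map (algebraMap (S ⧸ Ideal.span {h}) T)).IsPrime :=
      IsLocalization.isPrime_of_isPrime_disjoint (Submonoid.powers (Ideal.Quotient.mk (Ideal.span {h}) a₀)) _ Q hQ hdisj
    have hQ'c : (Q.map (algebraMap (S ⧸ Ideal.span {h}) T)).comap (algebraMap (S ⧸ Ideal.span {h}) T) = Q :=
      IsLocalization.under_map_of_isPrime_disjoint (Submonoid.powers (Ideal.Quotient.mk (Ideal.span {h}) a₀)) _ hQ hdisj
    haveI h1 : IsLocalization.AtPrime (Localization.AtPrime (Q.map (algebraMap (S ⧸ Ideal.span {h}) T))) Q := by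
      have := IsLocalization.isLocalization_isLocalization_atPrime_isLocalization
        (Submonoid.powers (Ideal.Quotient.mk (Ideal.span {h}) a₀)) (Localization.AtPrime (Q.map (algebraMap (S ⧸ Ideal.span {h}) T)))
        (Q.map (algebraMap (S ⧸ Ideal.span {h}) T))
      have key : ((Q.map (algebraMap (S ⧸ Ideal.span {h}) T)).comap (algebraMap (S ⧸ Ideal.span {h}) T)).primeCompl = Q.primeCompl := by
        ext c
        change c ∉ (Q.map (algebraMap (S ⧸ Ideal.span {h}) T)).comap (algebraMap (S ⧸ Ideal.span {h}) T) ↔ c ∉ Q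
        rw [hQ'c]
      dsimp only [IsLocalization.AtPrime] at this ⊢
      rwa [key] at this
    have e1 : Localization.AtPrime Q ≃ₐ[S ⧸ Ideal.span {h}] Localization.AtPrime (Q.map (algebraMap (S ⧸ Ideal.span {h}) T)) :=
      IsLocalization.algEquiv Q.primeCompl _ _
    have hreg : IsRegularLocalRing (Localization.AtPrime (Q.map (algebraMap (S ⧸ Ideal.span {h}) T))) :=
      (isRegularRing_iff.mp hT) (Q.map (algebraMap (S ⧸ Ideal.span {h}) T))
    exact IsRegularLocalRing.of_ringEquiv e1.toRingEquiv.symm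

/-! ## §3 The chart: graph-type strict transforms are regular rings -/

variable {R : Type u} [CommRing R] {r : ℕ} (x : Fin r → R) (i : Fin r)

/-- The coefficient of `T_{j₀}` in `T_{j₀} + q(T_j : j ≠ j₀)` is `1`. [plumbing] -/
theorem coeff_single_X_add_rename (j₀ : {j : Fin r // j ≠ i}) (q : MvPolynomial {j : {j : Fin r // j ≠ i} // j ≠ j₀} R) :
    coeff (Finsupp.single j₀ 1) (X j₀ + rename (fun j : {j : {j : Fin r // j ≠ i} // j ≠ j₀} => (j : {j : Fin r // j ≠ i})) q) = 1 := by
  classical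
  have h0 : coeff (Finsupp.single j₀ 1) (rename (fun j : {j : {j : Fin r // j ≠ i} // j ≠ j₀} => (j : {j : Fin r // j ≠ i})) q) = 0 := by
    refine coeff_rename_eq_zero _ _ _ fun u hu => ?_
    exfalso
    have h := congrArg (fun d => d j₀) hu
    simp only [Finsupp.single_eq_same] at h
    rw [Finsupp.mapDomain_notin_range] at h
    · exact zero_ne_one h
    · rintro ⟨j, hj⟩; exact j.2 hj
  rw [coeff_add, h0, add_zero, coeff_X, if_pos rfl]

/-- **`h′ = eval (T_{j₀} + q) ∉ (xᵢ/1)`**: its `T_{j₀}`-coefficient `1` is not in `I` (coefficient test, Stacks 0BIQ). [cite: StacksProject, Tag 0BIQ] -/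
theorem eval_X_add_rename_not_mem_span (hx : IsQuasiRegular x) (hI : Ideal.span (Set.range x) ≠ ⊤) (j₀ : {j : Fin r // j ≠ i})
    (q : MvPolynomial {j : {j : Fin r // j ≠ i} // j ≠ j₀} R) :
    blowupAlgebra.eval x i (X j₀ + rename (fun j : {j : {j : Fin r // j ≠ i} // j ≠ j₀} => (j : {j : Fin r // j ≠ i})) q) ∉
      Ideal.span {algebraMap R (blowupAlgebra (Ideal.span (Set.range x)) (x i)) (x i)} := by
  intro h
  rw [blowupAlgebra.eval_mem_span_algebraMap_iff x i hx] at h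
  have h1 := h (Finsupp.single j₀ 1)
  rw [coeff_single_X_add_rename] at h1
  exact hI ((Ideal.eq_top_iff_one _).mpr h1)

/-- **`B/(xᵢ, h′) ≅ (R/I)[T_j : j ≠ i]/(T_{j₀} + q̄)`** for graph-type `h′ = eval (T_{j₀} + q)`: the relations modulo `xᵢ` are `I·R[T]` (Stacks 0BIQ,
`blowupAlgebra.quotientMapEvalEquiv`). [cite: StacksProject, Tag 0BIQ] -/
theorem nonempty_ringEquiv_quotient_sup (hx : IsQuasiRegular x) (j₀ : {j : Fin r // j ≠ i}) (q : MvPolynomial {j : {j : Fin r // j ≠ i} // j ≠ j₀} R) :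
    Nonempty ((blowupAlgebra (Ideal.span (Set.range x)) (x i) ⧸
        (Ideal.span {algebraMap R (blowupAlgebra (Ideal.span (Set.range x)) (x i)) (x i)} ⊔
          Ideal.span {blowupAlgebra.eval x i (X j₀ + rename (fun j : {j : {j : Fin r // j ≠ i} // j ≠ j₀} => (j : {j : Fin r // j ≠ i})) q)})) ≃+*
      (MvPolynomial {j : Fin r // j ≠ i} (R ⧸ Ideal.span (Set.range x)) ⧸
        Ideal.span {X j₀ + rename (fun j : {j : {j : Fin r // j ≠ i} // j ≠ j₀} => (j : {j : Fin r // j ≠ i}))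
          (MvPolynomial.map (Ideal.Quotient.mk (Ideal.span (Set.range x))) q)})) := by
  classical
  -- `M = I·R[T] + (H)` and `eval(M) = (xᵢ/1) + (h′)`
  have hMC : (Ideal.map (C : R →+* MvPolynomial {j : Fin r // j ≠ i} R) (Ideal.span (Set.range x))).map (blowupAlgebra.eval x i).toRingHom =
      Ideal.span {algebraMap R (blowupAlgebra (Ideal.span (Set.range x)) (x i)) (x i)} := by
    rw [Ideal.map_map]
    have hcomp : (blowupAlgebra.eval x i).toRingHom.comp C = algebraMap R (blowupAlgebra (Ideal.span (Set.range x)) (x i)) :=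
      RingHom.ext fun c => blowupAlgebra.eval_C x i c
    rw [hcomp, map_blowupAlgebra_eq_span (blowupAlgebra.mem_span_range x i)]
  have hM : (Ideal.map C (Ideal.span (Set.range x)) ⊔
      Ideal.span {X j₀ + rename (fun j : {j : {j : Fin r // j ≠ i} // j ≠ j₀} => (j : {j : Fin r // j ≠ i})) q}).map (blowupAlgebra.eval x i).toRingHom =
      Ideal.span {algebraMap R (blowupAlgebra (Ideal.span (Set.range x)) (x i)) (x i)} ⊔
        Ideal.span {blowupAlgebra.eval x i (X j₀ + rename (fun j : {j : {j : Fin r // j ≠ i} // j ≠ j₀} => (j : {j : Fin r // j ≠ i})) q)} := by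
    rw [Ideal.map_sup, hMC, Ideal.map_span, Set.image_singleton]; rfl
  have hker : RingHom.ker (blowupAlgebra.eval x i).toRingHom ≤ Ideal.map C (Ideal.span (Set.range x)) ⊔
      Ideal.span {X j₀ + rename (fun j : {j : {j : Fin r // j ≠ i} // j ≠ j₀} => (j : {j : Fin r // j ≠ i})) q} := by
    refine le_trans ?_ le_sup_left
    rw [RingHom.ker_eq_comap_bot, ← blowupAlgebra.comap_eval_span_algebraMap_eq x i hx]
    exact Ideal.comap_mono bot_le
  -- `B/((xᵢ) + (h′)) = B/eval(M) ≅ R[T]/M`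
  have e2 := (Ideal.quotEquivOfEq hM.symm).trans (blowupAlgebra.quotientMapEvalEquiv x i hker)
  -- `R[T]/M ≅ (R/I)[T]/(H̄)`: the kernel of `R[T] → (R/I)[T] → (R/I)[T]/(H̄)` is `M`
  have hHbar : MvPolynomial.map (Ideal.Quotient.mk (Ideal.span (Set.range x)))
      (X j₀ + rename (fun j : {j : {j : Fin r // j ≠ i} // j ≠ j₀} => (j : {j : Fin r // j ≠ i})) q) =
      X j₀ + rename (fun j : {j : {j : Fin r // j ≠ i} // j ≠ j₀} => (j : {j : Fin r // j ≠ i}))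
        (MvPolynomial.map (Ideal.Quotient.mk (Ideal.span (Set.range x))) q) := by
    rw [map_add, map_X, map_rename]
  have hsurj : Function.Surjective (MvPolynomial.map (σ := {j : Fin r // j ≠ i}) (Ideal.Quotient.mk (Ideal.span (Set.range x)))) :=
    map_surjective _ Ideal.Quotient.mk_surjective
  have hg : Function.Surjective ((Ideal.Quotient.mk (Ideal.span {X j₀ + rename (fun j : {j : {j : Fin r // j ≠ i} // j ≠ j₀} => (j : {j : Fin r // j ≠ i}))
      (MvPolynomial.map (Ideal.Quotient.mk (Ideal.span (Set.range x))) q)})).comp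
      (MvPolynomial.map (σ := {j : Fin r // j ≠ i}) (Ideal.Quotient.mk (Ideal.span (Set.range x))))) :=
    Ideal.Quotient.mk_surjective.comp hsurj
  have hkerg : RingHom.ker ((Ideal.Quotient.mk (Ideal.span {X j₀ + rename (fun j : {j : {j : Fin r // j ≠ i} // j ≠ j₀} => (j : {j : Fin r // j ≠ i}))
      (MvPolynomial.map (Ideal.Quotient.mk (Ideal.span (Set.range x))) q)})).comp
      (MvPolynomial.map (σ := {j : Fin r // j ≠ i}) (Ideal.Quotient.mk (Ideal.span (Set.range x))))) =
      Ideal.map C (Ideal.span (Set.range x)) ⊔ Ideal.span {X j₀ + rename (fun j : {j : {j : Fin r // j ≠ i} // j ≠ j₀} => (j : {j : Fin r // j ≠ i})) q} := by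
    have hspan : Ideal.span {X j₀ + rename (fun j : {j : {j : Fin r // j ≠ i} // j ≠ j₀} => (j : {j : Fin r // j ≠ i}))
        (MvPolynomial.map (Ideal.Quotient.mk (Ideal.span (Set.range x))) q)} =
        (Ideal.span {X j₀ + rename (fun j : {j : {j : Fin r // j ≠ i} // j ≠ j₀} => (j : {j : Fin r // j ≠ i})) q}).map
          (MvPolynomial.map (σ := {j : Fin r // j ≠ i}) (Ideal.Quotient.mk (Ideal.span (Set.range x)))) := by
      rw [Ideal.map_span (MvPolynomial.map (σ := {j : Fin r // j ≠ i}) (Ideal.Quotient.mk (Ideal.span (Set.range x)))), Set.image_singleton, hHbar]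
    rw [← RingHom.comap_ker, Ideal.mk_ker, hspan, Ideal.comap_map_of_surjective _ hsurj, ← RingHom.ker_eq_comap_bot, MvPolynomial.ker_map,
      Ideal.mk_ker, sup_comm]
  have e34 := (Ideal.quotEquivOfEq hkerg.symm).trans (RingHom.quotientKerEquivOfSurjective hg)
  exact ⟨e2.trans e34⟩

/-- **`(B/(h))[1/x̄ᵢ] = L/(h·L)`**, `L = R[1/xᵢ]`: `L` is the localisation of `B` at `xᵢ/1` (Stacks 07Z3 (3), `blowupAlgebra.isLocalization_away`), and localisation
commutes with quotients (Mathlib). [cite: StacksProject, Tag 07Z3] -/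
theorem isLocalization_away_quotient (h : blowupAlgebra (Ideal.span (Set.range x)) (x i)) :
    IsLocalization.Away (Ideal.Quotient.mk (Ideal.span {h}) (algebraMap R (blowupAlgebra (Ideal.span (Set.range x)) (x i)) (x i)))
      (Localization.Away (x i) ⧸ (Ideal.span {h}).map (algebraMap (blowupAlgebra (Ideal.span (Set.range x)) (x i)) (Localization.Away (x i)))) := by
  haveI := blowupAlgebra.isLocalization_away (Ideal.span (Set.range x)) (x i)
  rw [IsLocalization.Away, ← Ideal.Quotient.algebraMap_eq, ← Algebra.algebraMapSubmonoid_powers]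
  infer_instance

/-- ★★ **Graph-type strict transforms are regular rings.** `R` Noetherian, `x` quasi-regular with `R/(x)` a regular domain, `B = R[I/xᵢ] ⊆ L = R[1/xᵢ]`,
`h′ = x_{j₀}/xᵢ + q(x_j/xᵢ : j ≠ i, j₀)`; if `L/(h′·L)` (the hypersurface off `V(xᵢ)`) is a regular ring then so is `B/(h′)`. [folklore; cite: Liu2002, Thm. 8.1.19 (a)]
[cite: StacksProject, Tag 0BIQ; Tag 07Z3] -/
theorem isRegularRing_quotient_eval_graphType [IsNoetherianRing R] (hx : IsQuasiRegular x)
    [IsDomain (R ⧸ Ideal.span (Set.range x))] [IsRegularRing (R ⧸ Ideal.span (Set.range x))] (j₀ : {j : Fin r // j ≠ i})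
    (q : MvPolynomial {j : {j : Fin r // j ≠ i} // j ≠ j₀} R)
    (hoff : IsRegularRing (Localization.Away (x i) ⧸
      (Ideal.span {blowupAlgebra.eval x i (X j₀ + rename (fun j : {j : {j : Fin r // j ≠ i} // j ≠ j₀} => (j : {j : Fin r // j ≠ i})) q)}).map
        (algebraMap (blowupAlgebra (Ideal.span (Set.range x)) (x i)) (Localization.Away (x i))))) :
    IsRegularRing (blowupAlgebra (Ideal.span (Set.range x)) (x i) ⧸
      Ideal.span {blowupAlgebra.eval x i (X j₀ + rename (fun j : {j : {j : Fin r // j ≠ i} // j ≠ j₀} => (j : {j : Fin r // j ≠ i})) q)}) := by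
  classical
  haveI : IsNoetherianRing (blowupAlgebra (Ideal.span (Set.range x)) (x i)) := isNoetherianRing_blowupAlgebra x i
  have hI : Ideal.span (Set.range x) ≠ ⊤ := fun h =>
    (Ideal.Quotient.zero_ne_one_iff.mp (zero_ne_one' (R ⧸ Ideal.span (Set.range x)))) h
  have hnzd := mk_mem_nonZeroDivisors_of_not_mem (blowupAlgebra.isPrime_span_algebraMap x i hx)
    (algebraMap_mem_nonZeroDivisors_blowupAlgebra (I := Ideal.span (Set.range x)) (a := x i)) (eval_X_add_rename_not_mem_span x i hx hI j₀ q)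
  have hE : IsRegularRing (blowupAlgebra (Ideal.span (Set.range x)) (x i) ⧸
      (Ideal.span {algebraMap R (blowupAlgebra (Ideal.span (Set.range x)) (x i)) (x i)} ⊔
        Ideal.span {blowupAlgebra.eval x i (X j₀ + rename (fun j : {j : {j : Fin r // j ≠ i} // j ≠ j₀} => (j : {j : Fin r // j ≠ i})) q)})) := by
    obtain ⟨e⟩ := nonempty_ringEquiv_quotient_sup x i hx j₀ q
    haveI := isRegularRing_quotient_X_add_rename (A := R ⧸ Ideal.span (Set.range x)) j₀
      (MvPolynomial.map (Ideal.Quotient.mk (Ideal.span (Set.range x))) q)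
    exact IsRegularRing.of_ringEquiv (R := MvPolynomial {j : Fin r // j ≠ i} (R ⧸ Ideal.span (Set.range x)) ⧸
      Ideal.span {X j₀ + rename (fun j : {j : {j : Fin r // j ≠ i} // j ≠ j₀} => (j : {j : Fin r // j ≠ i}))
        (MvPolynomial.map (Ideal.Quotient.mk (Ideal.span (Set.range x))) q)}) e.symm
  haveI := isLocalization_away_quotient x i
    (blowupAlgebra.eval x i (X j₀ + rename (fun j : {j : {j : Fin r // j ≠ i} // j ≠ j₀} => (j : {j : Fin r // j ≠ i})) q))
  exact isRegularRing_quotient_of_sup_of_away _ _ hnzd hE hoff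

/-! ## §4 The ODP family `𝒩 = x_p x_{p'} + x_q x_{q'}` -/

/-- On the chart `x_p`: `𝒩/1 = (x_p/1)² · (x_{p'}/x_p + (x_q/x_p)(x_{q'}/x_p))`. [folklore; cite: DeJong1996, 4.27 (p. 76)] -/
theorem algebraMap_odp_eq (p p' q q' : Fin r) :
    algebraMap R (blowupAlgebra (Ideal.span (Set.range x)) (x p)) (x p * x p' + x q * x q') =
      algebraMap R (blowupAlgebra (Ideal.span (Set.range x)) (x p)) (x p) ^ 2 *
        (blowupAlgebra.frac x p p' + blowupAlgebra.frac x p q * blowupAlgebra.frac x p q') := by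
  have hp' := blowupAlgebra.algebraMap_mul_gen (Ideal.span (Set.range x)) (x p) (x p') (blowupAlgebra.mem_span_range x p')
  have hq := blowupAlgebra.algebraMap_mul_gen (Ideal.span (Set.range x)) (x p) (x q) (blowupAlgebra.mem_span_range x q)
  have hq' := blowupAlgebra.algebraMap_mul_gen (Ideal.span (Set.range x)) (x p) (x q') (blowupAlgebra.mem_span_range x q')
  rw [map_add, map_mul, map_mul, ← hp', ← hq, ← hq']
  change _ = _ * (blowupAlgebra.gen _ _ _ _ + blowupAlgebra.gen _ _ _ _ * blowupAlgebra.gen _ _ _ _)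
  ring

/-- The ODP strict transform on the chart `x_p` as the evaluation of the graph-type polynomial `T_{p'} + T_q T_{q'}`. [plumbing] -/
theorem eval_odp_eq (p p' q q' : Fin r) (hp' : p' ≠ p) (hq : q ≠ p) (hq' : q' ≠ p) (hqp' : q ≠ p') (hq'p' : q' ≠ p') :
    blowupAlgebra.eval x p (X ⟨p', hp'⟩ + rename (fun j : {j : {j : Fin r // j ≠ p} // j ≠ ⟨p', hp'⟩} => (j : {j : Fin r // j ≠ p}))
        (X ⟨⟨q, hq⟩, fun h => hqp' (congrArg Subtype.val h)⟩ * X ⟨⟨q', hq'⟩, fun h => hq'p' (congrArg Subtype.val h)⟩)) =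
      blowupAlgebra.frac x p p' + blowupAlgebra.frac x p q * blowupAlgebra.frac x p q' := by
  rw [map_mul, rename_X, rename_X, map_add, map_mul, blowupAlgebra.eval_X, blowupAlgebra.eval_X, blowupAlgebra.eval_X]

/-- `x_p/1 ∤ h′_p` (coefficient test). [cite: StacksProject, Tag 0BIQ] -/
theorem not_dvd_odp (hx : IsQuasiRegular x) (hI : Ideal.span (Set.range x) ≠ ⊤) (p p' q q' : Fin r) (hp' : p' ≠ p) (hq : q ≠ p) (hq' : q' ≠ p)
    (hqp' : q ≠ p') (hq'p' : q' ≠ p') :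
    ¬ algebraMap R (blowupAlgebra (Ideal.span (Set.range x)) (x p)) (x p) ∣
      blowupAlgebra.frac x p p' + blowupAlgebra.frac x p q * blowupAlgebra.frac x p q' := by
  rw [← eval_odp_eq x p p' q q' hp' hq hq' hqp' hq'p', ← Ideal.mem_span_singleton]
  exact eval_X_add_rename_not_mem_span x p hx hI ⟨p', hp'⟩ _

/-- In `L = R[1/x_p]`: `(h′_p) = (𝒩)` as ideals (`x_p/1` is a unit there). [plumbing] -/
theorem map_span_odp_eq (p p' q q' : Fin r) :
    (Ideal.span {blowupAlgebra.frac x p p' + blowupAlgebra.frac x p q * blowupAlgebra.frac x p q'}).map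
        (algebraMap (blowupAlgebra (Ideal.span (Set.range x)) (x p)) (Localization.Away (x p))) =
      Ideal.span {algebraMap R (Localization.Away (x p)) (x p * x p' + x q * x q')} := by
  rw [Ideal.map_span, Set.image_singleton]
  have h := congrArg (fun b : blowupAlgebra (Ideal.span (Set.range x)) (x p) => (b : Localization.Away (x p))) (algebraMap_odp_eq x p p' q q')
  simp only [Subalgebra.coe_algebraMap, Subalgebra.coe_mul, Subalgebra.coe_pow] at h
  rw [h]
  exact (Ideal.span_singleton_mul_left_unit ((IsLocalization.Away.algebraMap_isUnit (x p)).pow 2) _).symm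

/-- ★★ **The ODP family: `R[I/x_p]/(x_{p'}/x_p + (x_q/x_p)(x_{q'}/x_p))` is a regular ring provided `R[1/x_p]/(𝒩)` is** (`R` Noetherian, `x` quasi-regular, `R/(x)` a
regular domain, `𝒩 = x_p x_{p'} + x_q x_{q'}`, indices `p ∉ {p', q, q'}`, `p' ∉ {q, q'}`). With `algebraMap_odp_eq`, `Cruxes.EquisingularLiftNat.Sections.prime_algebraMap_of_isQuasiRegular`,
`not_dvd_odp` and `BlowupAlgebraStrictTransform.quotientKerBlowupAlgebraMapEquiv` this is the regularity of the `x_p`-chart of the blowing up of `R/(𝒩)` along `(x)`; the other three charts by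
symmetry. [folklore; cite: DeJong1996, 4.27 (p. 76)] [cite: Liu2002, Thm. 8.1.19 (a)] -/
theorem isRegularRing_quotient_odp [IsNoetherianRing R] (hx : IsQuasiRegular x)
    [IsDomain (R ⧸ Ideal.span (Set.range x))] [IsRegularRing (R ⧸ Ideal.span (Set.range x))]
    (p p' q q' : Fin r) (hp' : p' ≠ p) (hq : q ≠ p) (hq' : q' ≠ p) (hqp' : q ≠ p') (hq'p' : q' ≠ p')
    (hoff : IsRegularRing (Localization.Away (x p) ⧸ Ideal.span {algebraMap R (Localization.Away (x p)) (x p * x p' + x q * x q')})) :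
    IsRegularRing (blowupAlgebra (Ideal.span (Set.range x)) (x p) ⧸
      Ideal.span {blowupAlgebra.frac x p p' + blowupAlgebra.frac x p q * blowupAlgebra.frac x p q'}) := by
  -- the hypothesis in the chart's form
  have hoff' : IsRegularRing (Localization.Away (x p) ⧸
      (Ideal.span {blowupAlgebra.frac x p p' + blowupAlgebra.frac x p q * blowupAlgebra.frac x p q'}).map
        (algebraMap (blowupAlgebra (Ideal.span (Set.range x)) (x p)) (Localization.Away (x p)))) :=
    IsRegularRing.of_ringEquiv (R := Localization.Away (x p) ⧸ Ideal.span {algebraMap R (Localization.Away (x p)) (x p * x p' + x q * x q')})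
      (Ideal.quotEquivOfEq (map_span_odp_eq x p p' q q').symm)
  -- rewrite the defining element as the evaluation of the graph-type polynomial, inside Props only
  have key : ∀ (h : blowupAlgebra (Ideal.span (Set.range x)) (x p)),
      h = blowupAlgebra.eval x p (X ⟨p', hp'⟩ + rename (fun j : {j : {j : Fin r // j ≠ p} // j ≠ ⟨p', hp'⟩} => (j : {j : Fin r // j ≠ p}))
        (X ⟨⟨q, hq⟩, fun h => hqp' (congrArg Subtype.val h)⟩ * X ⟨⟨q', hq'⟩, fun h => hq'p' (congrArg Subtype.val h)⟩)) →
      IsRegularRing (Localization.Away (x p) ⧸ (Ideal.span {h}).map (algebraMap (blowupAlgebra (Ideal.span (Set.range x)) (x p)) (Localization.Away (x p)))) →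
      IsRegularRing (blowupAlgebra (Ideal.span (Set.range x)) (x p) ⧸ Ideal.span {h}) := by
    rintro h rfl hh
    exact isRegularRing_quotient_eval_graphType x p hx ⟨p', hp'⟩ _ hh
  exact key _ (eval_odp_eq x p p' q q' hp' hq hq' hqp' hq'p').symm hoff'

end Summit.ResolutionOfSingularities.ResolutionOfSingularities.Theorems.FInjectiveMacaulayfication.StrictTransformGraphType

end
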